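import Literature.NumberTheory.LFunctions.RosserSchoenfeldMertensFirstConstant
import Literature.NumberTheory.LFunctions.RosserSchoenfeldEq321FromDusart
import Literature.NumberTheory.LFunctions.MertensSecondErrorPositive
import Literature.NumberTheory.LFunctions.MertensThirdErrorPositive
import HarnessLib

/-!
# Rosser–Schoenfeld 1962, Theorems 5 and 7: explicit Mertens II and III
# (`Σ_{p ≤ x} 1/p` against `log log x + B ± 1/(2 log² x)`; `∏_{p ≤ x}(1 − 1/p)` against `e^{−γ}/log x`)

Topic `Literature/NumberTheory/LFunctions`, continuing `RosserSchoenfeldMertensFirst.lean` (Theorem 6,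
(3.21)–(3.24), for `Σ_{p ≤ x} (log p)/p`; its docstring: "Deliberately NOT here: Theorems 5, 7–8"). Source:
J. B. Rosser, L. Schoenfeld, *Approximate formulas for some functions of prime numbers*, Illinois J. Math.
6 (1962) 64–94, §3, p. 70 (held: `lit read doi:10.1215/ijm/1255631807`, p0007; the OCR of that page is
poor, the displays are confirmed verbatim against C. Axler, *New estimates for some prime functions*,
arXiv:1703.08032, §5 display after (5.3) and §6 (6.1), which restate them with the ranges), with the
Meissel–Mertens constant `B = γ + Σ_p (log(1 − 1/p) + 1/p) = 0.26149 72128…` (RS62 (2.7); the tree's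
`Mertens.meisselMertens`, Hardy–Wright (22.8.1)) and Euler's constant `γ` (RS62's `C`):

* **Theorem 5.** (3.17) `log log x + B − 1/(2 log² x) < Σ_{p ≤ x} 1/p` for `1 < x`;
  (3.18) `Σ_{p ≤ x} 1/p < log log x + B + 1/(2 log² x)` for `286 ≤ x`.
  Corollary: (3.19) `log log x < Σ_{p ≤ x} 1/p` for `1 < x`; (3.20) `Σ_{p ≤ x} 1/p < log log x + B + 1/log² x`
  for `1 < x`.
* **Theorem 7.** (3.25) `e^{−γ}/log x · (1 − 1/(2 log² x)) < ∏_{p ≤ x} (1 − 1/p)` for `285 ≤ x`;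
  (3.26) `∏_{p ≤ x} (1 − 1/p) < e^{−γ}/log x · (1 + 1/(2 log² x))` for `1 < x`.
  Corollary (3.27): `e^{−γ}/log x · (1 − 1/log² x) < ∏_{p ≤ x}(1 − 1/p)` for `1 < x`.
* **Theorem 8** ("a variant of Theorem 7 which is sometimes more convenient", p. 68): (3.28)
  `e^{γ} log x · (1 − 1/(2 log² x)) < ∏_{p ≤ x} p/(p − 1)` for `1 < x`; (3.29)
  `∏_{p ≤ x} p/(p − 1) < e^{γ} log x · (1 + 1/(2 log² x))` for `286 ≤ x`; Cor. 1 (3.30) with `1/log² x`, `1 < x`.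

RS62 prove these (§8, p. 87) from their identity (4.20)/(4.21) expressing the sums through `θ`, their
`θ`-bounds (Table I), Theorems 20/23 (`16 000 ≤ x ≤ 10⁸`) and the Rosser–Walker tabulation (`x ≤ 16 000`).

## What this file PROVES and what it only NAMES

NAMED FACTS (four `def … : Prop`, cited, hypotheses complete, as printed): `RosserSchoenfeld1962_eq_3_17`,
`RosserSchoenfeld1962_eq_3_18`, `RosserSchoenfeld1962_eq_3_25`, `RosserSchoenfeld1962_eq_3_26`.

PROVED here (no hypothesis beyond what is named in each statement):
* §2 the ANALYTIC STEP of Theorem 5 from a `θ`-bound of the now-standard shape: if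
  `|θ(y) − y| ≤ η y/log² y` for `y ≥ X ≥ 2` then for every `x ≥ X`
  `|Σ_{p ≤ x} 1/p − log log x − B| ≤ 2η(1 + 1/log X)/log² x`
  (`abs_primeRecipSum_sub_loglog_sub_meisselMertens_le_of_theta`) — by the tree's exact formula
  `Σ_{p≤x} 1/p − log log x − B = (τ(x) − E)/log x − ∫_x^∞ (τ(t) − E) dt/(t log² t)`
  (`Mertens.primeRecipSum_sub_loglog_sub_eq`, Hardy–Wright (22.7.3)) and the tree's `θ`-step for
  `τ(t) − E = Σ_{p≤t}(log p)/p − log t − E` (`abs_sum_primesLE_log_div_sub_log_sub_rosserSchoenfeldE_le_of_theta`,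
  RS62 (4.21)); hence **Theorem 5 at every `x ≥ X` as soon as `2η(1 + 1/log X) < 1/2`**
  (`RosserSchoenfeld1962_thm5_of_theta`), and in particular **(3.17) ∧ (3.18) for every `x ≥ 3 594 641`
  from the tree's named fact `Dusart2010_theta_thm_5_2`** (`|θ(x) − x| < 0.2 x/log² x`, `x ≥ 3 594 641`;
  `RosserSchoenfeld1962_thm5_of_dusart`; `2·0.2·(1 + 1/log 3594641) < 1/2` because `log 3594641 > 4`).
  This is the range every current consumer uses (the Parity cell's sieve certificates apply (3.17)/(3.18) at
  `x ≥ 10⁷`).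
* §3 **(3.17) for `1 < x < 358 811` UNCONDITIONALLY** (`RosserSchoenfeld1962_eq_3_17_of_lt`), from the tree's
  kernel certificate `E₂(x) = Σ_{p≤x} 1/p − log log x − B > 0` on `[2, 358811)`
  (`MertensSecondChain.loglog_add_meisselMertens_lt_primeRecipSum`, `MertensSecondErrorPositive.lean`; RS62 Thm 20 record
  `E₂ > 0` up to `10⁸`), and the Corollary **(3.19) for all `x > 1` from (3.17)** (`RosserSchoenfeld1962_eq_3_19_of_3_17`;
  unconditional below `358 811`).
* §4 the CONSUMER SHAPES: the symmetric envelope `|Σ_{p≤x} 1/p − log log x − B| < 1/(2 log² x)` (`x ≥ 286`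
  from the two facts; `x ≥ 3 594 641` from Dusart's fact alone) and the two-sided bounds for block sums
  `Σ_{y < p ≤ z} 1/p = P(z) − P(y)` against `log log z − log log y`.
* §5 Mertens' product: `∏_{p≤x}(1 − 1/p) = (e^{−γ}/log x) · exp(T(x) − E₂(x))` with
  `0 ≤ T(x) = Σ_{p > x} (−log(1 − 1/p) − 1/p) ≤ 2/⌊x⌋` (`prod_one_sub_inv_eq_exp`); hence the product
  bounds from a bound on `E₂` / from a `θ`-bound (`prod_one_sub_inv_bounds_of_abs_le`,
  `prod_one_sub_inv_bounds_of_theta`), **(3.25) ∧ (3.26) for `x ≥ 3 594 641` from Dusart's fact**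
  (`RosserSchoenfeld1962_thm7_of_dusart`), **(3.26) and (3.28) for `1 < x < 358 811` unconditionally** from the
  tree's `E₃ > 0` certificate (`MertensThirdErrorPositive.lean`; `RosserSchoenfeld1962_eq_3_26_of_lt`,
  `RosserSchoenfeld1962_eq_3_28_of_lt`), and **(3.28) from (3.26)** ("Inverting both sides gives (3.28)", RS62
  p. 87; `RosserSchoenfeld1962_eq_3_28_of_3_26`, `RosserSchoenfeld1962_eq_3_28_of_dusart`).

NOT vendored: (3.20), (3.27), (3.29), (3.30) (one-line weakenings / the inverted form of (3.25), whose
printed range `286 ≤ x` differs from (3.25)'s `285 ≤ x` by a table check); the gap `358 811 ≤ x < 3 594 641`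
of (3.17) and the range `286 ≤ x < 3 594 641` of (3.18) are NOT certified here (they would take an extension of
the `E₂`-chain of `MertensSecondChainCheck.lean`, as `RosserSchoenfeldEq321Tabulated.lean` did for (3.21)).

## References
* J. B. Rosser, L. Schoenfeld, Illinois J. Math. 6 (1962) 64–94: (2.7) (the constant `B`), Thm 5 (3.17)–(3.20),
  Thm 7 (3.25)–(3.27), Thm 8 (3.28)–(3.30), p. 70; proofs §8, p. 87; (4.20)–(4.21). [RosserSchoenfeld1962]
* C. Axler, *New estimates for some prime functions*, arXiv:1703.08032 (2017), §5 (display after (5.3)) and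
  §6 (6.1) (verbatim restatement of RS62 Thms 5 and 7 with their ranges). [secondary, for the OCR check only]
* P. Dusart, *Estimates of some functions over primes without R.H.*, arXiv:1002.0442 (2010), Thm 5.2
  (`k = 2`: `η₂ = 0.2`, `x₂ = 3 594 641`) — the tree's `Dusart2010_theta_thm_5_2`. [Dusart2010]
* G. H. Hardy, E. M. Wright, *An Introduction to the Theory of Numbers*, 6th ed., §22.7 (22.7.3), §22.8
  (22.8.1). [HardyWright2008]
-/

noncomputable section

open Filter Topology Set MeasureTheory Finset Real
open scoped Chebyshev

namespace Literature.NumberTheory.LFunctions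

open Mertens (primeRecipSum meisselMertens mertensTau primeLogCoeffSubInv)

/-! ## §1 Theorem 5 — the named facts (3.17), (3.18) -/

/-- NAMED FACT (**Rosser–Schoenfeld 1962, Thm. 5, (3.17)**): for real `x > 1`,
`log log x + B − 1/(2 log² x) < Σ_{p ≤ x} 1/p`, `B` the Meissel–Mertens constant (RS62 (2.7); the tree's
`Mertens.meisselMertens`). PROVED in the tree for `1 < x < 358 811` (`RosserSchoenfeld1962_eq_3_17_of_lt`) and,
from `Dusart2010_theta_thm_5_2`, for `x ≥ 3 594 641` (`RosserSchoenfeld1962_thm5_of_dusart`); users needing the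
full printed range take `(h : RosserSchoenfeld1962_eq_3_17)`.
[cite: RosserSchoenfeld1962, Thm. 5 (3.17), p. 70] -/
def RosserSchoenfeld1962_eq_3_17 : Prop :=
  ∀ x : ℝ, 1 < x →
    Real.log (Real.log x) + meisselMertens - 1 / (2 * Real.log x ^ 2) < ∑ p ∈ Nat.primesLE ⌊x⌋₊, (p : ℝ)⁻¹

/-- NAMED FACT (**Rosser–Schoenfeld 1962, Thm. 5, (3.18)**): for real `x ≥ 286`,
`Σ_{p ≤ x} 1/p < log log x + B + 1/(2 log² x)`. PROVED in the tree, from `Dusart2010_theta_thm_5_2`, for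
`x ≥ 3 594 641` (`RosserSchoenfeld1962_thm5_of_dusart`); the range `286 ≤ x < 3 594 641` rests on RS62's
tables (Rosser–Walker to `16 000`, Thm 20 to `10⁸`). [cite: RosserSchoenfeld1962, Thm. 5 (3.18), p. 70] -/
def RosserSchoenfeld1962_eq_3_18 : Prop :=
  ∀ x : ℝ, 286 ≤ x →
    ∑ p ∈ Nat.primesLE ⌊x⌋₊, (p : ℝ)⁻¹ < Real.log (Real.log x) + meisselMertens + 1 / (2 * Real.log x ^ 2)

/-- The sum in (3.17)–(3.18) is the tree's `Mertens.primeRecipSum x = Σ_{p ≤ x} 1/p` (definitional).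
[cite: RosserSchoenfeld1962, Thm. 5, p. 70] -/
theorem primeRecipSum_def (x : ℝ) : primeRecipSum x = ∑ p ∈ Nat.primesLE ⌊x⌋₊, (p : ℝ)⁻¹ := rfl

/-! ## §2 The analytic step: Theorem 5 at `x ≥ X` from `|θ(y) − y| ≤ η y/log² y` (`y ≥ X`) -/

/-- **The large-`x` step of Theorem 5, two-sided.** If `|θ(y) − y| ≤ η y/log² y` for every `y ≥ X` (`X ≥ 2`,
`η ≥ 0`), then for every `x ≥ X`,
`|Σ_{p ≤ x} 1/p − log log x − B| ≤ 2η (1 + 1/log X)/log² x`.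
Proof: the exact formula `Σ_{p≤x} 1/p − log log x − B = (τ(x) − E)/log x − ∫_x^∞ (τ(t) − E) dt/(t log² t)`
(`Mertens.primeRecipSum_sub_loglog_sub_eq`) with `|τ(t) − E| ≤ η/log² t + η/log t ≤ η(1 + 1/log X)/log t`
for `t ≥ X` (RS62 (4.21), `abs_sum_primesLE_log_div_sub_log_sub_rosserSchoenfeldE_le_of_theta`) and
`∫_x^∞ dt/(t log³ t) = 1/(2 log² x) ≤ 1/log² x`. (RS62 use the sharper kernel of (4.20); the crude form
suffices for every `θ`-bound in print.) [cite: RosserSchoenfeld1962, (4.20)–(4.21) and §8 (proof of Thm. 5), p. 87] -/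
theorem abs_primeRecipSum_sub_loglog_sub_meisselMertens_le_of_theta {η X : ℝ} (hX : 2 ≤ X) (hη : 0 ≤ η)
    (hθ : ∀ y, X ≤ y → |θ y - y| ≤ η * y / Real.log y ^ 2) {x : ℝ} (hx : X ≤ x) :
    |primeRecipSum x - Real.log (Real.log x) - meisselMertens| ≤
      2 * η * (1 + 1 / Real.log X) / Real.log x ^ 2 := by
  have hx2 : 2 ≤ x := hX.trans hx
  have hx1 : 1 < x := by linarith
  have hlX : 0 < Real.log X := Real.log_pos (by linarith)
  have hlx : 0 < Real.log x := Real.log_pos hx1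
  set K : ℝ := η * (1 + 1 / Real.log X) with hK
  have hK0 : 0 ≤ K := by positivity
  -- pointwise bound on `τ(t) − E` for `t ≥ X`
  have hτ : ∀ t, X ≤ t → |mertensTau t - rosserSchoenfeldE| ≤ K / Real.log t := by
    intro t ht
    have h := abs_sum_primesLE_log_div_sub_log_sub_rosserSchoenfeldE_le_of_theta hX hθ ht
    have hlt : 0 < Real.log t := Real.log_pos (by linarith)
    have hlXt : Real.log X ≤ Real.log t := Real.log_le_log (by linarith) ht
    have e : mertensTau t - rosserSchoenfeldE =
        (∑ p ∈ Nat.primesLE ⌊t⌋₊, Real.log p / p) - Real.log t - rosserSchoenfeldE := by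
      rw [Mertens.mertensTau, Mertens.primeLogDivSum]
    rw [e]
    refine h.trans ?_
    have h1 : η / Real.log t ^ 2 ≤ η / Real.log X / Real.log t := by
      rw [pow_two, ← div_div]
      exact div_le_div_of_nonneg_right (div_le_div_of_nonneg_left hη hlX hlXt) hlt.le
    have e2 : K / Real.log t = η / Real.log X / Real.log t + η / Real.log t := by
      rw [hK]
      field_simp
      ring
    rw [e2]
    linarith
  rw [Mertens.primeRecipSum_sub_loglog_sub_eq hx2 rosserSchoenfeldE]
  have h1 : |(mertensTau x - rosserSchoenfeldE) / Real.log x| ≤ K / Real.log x ^ 2 := by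
    rw [abs_div, abs_of_pos hlx, pow_two, ← div_div]
    exact div_le_div_of_nonneg_right (hτ x hx) hlx.le
  have h2 : |∫ t in Ioi x, (mertensTau t - rosserSchoenfeldE) * (t⁻¹ / Real.log t ^ 2)| ≤
      K / Real.log x ^ 2 := by
    have h := Mertens.abs_integral_Ioi_mul_inv_div_log_pow_le (h := fun t ↦ mertensTau t - rosserSchoenfeldE)
      hx1 1 0 hK0 (fun t ht ↦ by simpa using hτ t (hx.trans ht.le))
    simpa using h
  calc |(mertensTau x - rosserSchoenfeldE) / Real.log x -
        ∫ t in Ioi x, (mertensTau t - rosserSchoenfeldE) * (t⁻¹ / Real.log t ^ 2)|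
      ≤ |(mertensTau x - rosserSchoenfeldE) / Real.log x| +
        |∫ t in Ioi x, (mertensTau t - rosserSchoenfeldE) * (t⁻¹ / Real.log t ^ 2)| := abs_sub _ _
    _ ≤ K / Real.log x ^ 2 + K / Real.log x ^ 2 := add_le_add h1 h2
    _ = 2 * η * (1 + 1 / Real.log X) / Real.log x ^ 2 := by rw [hK]; ring

/-- **Theorem 5 for `x ≥ X` from a `θ`-bound**: if `|θ(y) − y| ≤ η y/log² y` for `y ≥ X ≥ 2` and
`2η(1 + 1/log X) < 1/2`, then for every `x ≥ X` both (3.17) and (3.18) hold at `x`: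
`log log x + B − 1/(2 log² x) < Σ_{p ≤ x} 1/p < log log x + B + 1/(2 log² x)`.
[cite: RosserSchoenfeld1962, Thm. 5 (3.17)–(3.18), proof §8 p. 87] -/
theorem RosserSchoenfeld1962_thm5_of_theta {η X : ℝ} (hX : 2 ≤ X) (hη : 0 ≤ η)
    (hθ : ∀ y, X ≤ y → |θ y - y| ≤ η * y / Real.log y ^ 2)
    (hsmall : 2 * η * (1 + 1 / Real.log X) < 1 / 2) {x : ℝ} (hx : X ≤ x) :
    Real.log (Real.log x) + meisselMertens - 1 / (2 * Real.log x ^ 2) < primeRecipSum x ∧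
      primeRecipSum x < Real.log (Real.log x) + meisselMertens + 1 / (2 * Real.log x ^ 2) := by
  have h := abs_primeRecipSum_sub_loglog_sub_meisselMertens_le_of_theta hX hη hθ hx
  have hlx : 0 < Real.log x := Real.log_pos (by linarith)
  have hl2 : 0 < Real.log x ^ 2 := pow_pos hlx 2
  have hlt : 2 * η * (1 + 1 / Real.log X) / Real.log x ^ 2 < 1 / (2 * Real.log x ^ 2) := by
    rw [div_lt_div_iff₀ hl2 (by positivity)]
    nlinarith
  rw [abs_le] at h
  constructor <;> linarith [h.1, h.2]

/-- `log 3594641 > 4` (`e⁴ < 2.72⁴ < 55`). [folklore] -/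
private theorem four_lt_log_dusartX : 4 < Real.log 3594641 := by
  rw [Real.lt_log_iff_exp_lt (by norm_num)]
  have h1 : Real.exp 1 < 2.7182818286 := Real.exp_one_lt_d9
  have h4 : Real.exp 4 = Real.exp 1 ^ 4 := by rw [← Real.exp_nat_mul]; norm_num
  rw [h4]
  have h0 : 0 < Real.exp 1 := Real.exp_pos 1
  calc Real.exp 1 ^ 4 < 2.7182818286 ^ 4 := by gcongr
    _ < 3594641 := by norm_num

/-- **Theorem 5, (3.17) ∧ (3.18), for every `x ≥ 3 594 641`, from Dusart's `θ`-bound** (the tree's named fact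
`Dusart2010_theta_thm_5_2`: `|θ(x) − x| < 0.2 x/log² x` for `x ≥ 3 594 641`): `η = 0.2`, `X = 3 594 641`,
`2η(1 + 1/log X) < 0.4 · (1 + 1/4) = 1/2`. This covers every use at `x ≥ 10⁷` (the Parity cell's sieve
certificates). [cite: RosserSchoenfeld1962, Thm. 5 (3.17)–(3.18)] [cite: Dusart2010, Thm. 5.2 (k = 2)] -/
theorem RosserSchoenfeld1962_thm5_of_dusart (h : Dusart2010_theta_thm_5_2) {x : ℝ} (hx : 3594641 ≤ x) :
    Real.log (Real.log x) + meisselMertens - 1 / (2 * Real.log x ^ 2) < primeRecipSum x ∧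
      primeRecipSum x < Real.log (Real.log x) + meisselMertens + 1 / (2 * Real.log x ^ 2) := by
  refine RosserSchoenfeld1962_thm5_of_theta (η := 0.2) (X := 3594641) (by norm_num) (by norm_num)
    (fun y hy ↦ (h y hy).le) ?_ hx
  have hlog := four_lt_log_dusartX
  have h4 : 1 / Real.log 3594641 < 1 / 4 := by
    rw [one_div_lt_one_div (by linarith) (by norm_num)]
    exact hlog
  nlinarith

/-! ## §3 Unconditional ranges from the tree's kernel certificates, and the Corollary (3.19) -/

/-- `log 2 < 0.6931471808 < 1`. [folklore] -/
private theorem log_two_lt_one : Real.log 2 < 1 := by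
  have := Real.log_two_lt_d9
  linarith

/-- For `1 < x < 2` the sum `Σ_{p ≤ x} 1/p` is empty. [folklore] -/
private theorem primeRecipSum_eq_zero_of_lt_two {x : ℝ} (hx0 : 0 ≤ x) (hx : x < 2) : primeRecipSum x = 0 := by
  have hfl : ⌊x⌋₊ ≤ 1 := by
    have : ⌊x⌋₊ < 2 := (Nat.floor_lt hx0).2 (by exact_mod_cast hx)
    omega
  rw [primeRecipSum_def]
  have : Nat.primesLE ⌊x⌋₊ = ∅ := by
    interval_cases h : ⌊x⌋₊ <;> simp
  rw [this, Finset.sum_empty]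

/-- For `1 < x < 2`: `log log x + B − 1/(2 log² x) < 0` (`log log x < 0`, `B < 0.2615`, `1/(2 log² x) > 1`
since `log x < log 2 < 0.694`). [folklore] -/
private theorem lhs317_neg_of_lt_two {x : ℝ} (hx : 1 < x) (hx2 : x < 2) :
    Real.log (Real.log x) + meisselMertens - 1 / (2 * Real.log x ^ 2) < 0 := by
  have hl : 0 < Real.log x := Real.log_pos hx
  have hl2 : Real.log x < Real.log 2 := Real.log_lt_log (by linarith) hx2
  have hlog2 := Real.log_two_lt_d9
  have hll : Real.log (Real.log x) < 0 := Real.log_neg hl (by linarith)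
  have hB := MertensSecondChain.meisselMertens_lt'
  have hsq : 2 * Real.log x ^ 2 < 1 := by nlinarith
  have hinv : 1 < 1 / (2 * Real.log x ^ 2) := by
    rw [lt_div_iff₀ (by positivity)]
    linarith
  linarith

/-- **(3.17) for `1 < x < 358 811`, UNCONDITIONALLY**: from the tree's kernel certificate
`log log x + B < Σ_{p ≤ x} 1/p` on `[2, 358811)` (`MertensSecondChain.loglog_add_meisselMertens_lt_primeRecipSum`, i.e. RS62
Thm 20's `E₂(x) > 0`, certified there), and by hand on `(1, 2)` (empty sum, negative left side).
[cite: RosserSchoenfeld1962, Thm. 5 (3.17) and Thm. 20] -/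
theorem RosserSchoenfeld1962_eq_3_17_of_lt {x : ℝ} (hx : 1 < x) (hx' : x < 358811) :
    Real.log (Real.log x) + meisselMertens - 1 / (2 * Real.log x ^ 2) < primeRecipSum x := by
  rcases lt_or_ge x 2 with h2 | h2
  · rw [primeRecipSum_eq_zero_of_lt_two (by linarith) h2]
    exact lhs317_neg_of_lt_two hx h2
  · have h := MertensSecondChain.loglog_add_meisselMertens_lt_primeRecipSum h2 hx'
    have hl : 0 < Real.log x := Real.log_pos hx
    have : 0 < 1 / (2 * Real.log x ^ 2) := by positivity
    linarith

/-- `log 358811 > 12` (`e¹² < 2.72¹² < 358811`). [folklore] -/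
private theorem twelve_lt_log_358811 : 12 < Real.log 358811 := by
  rw [Real.lt_log_iff_exp_lt (by norm_num)]
  have h1 : Real.exp 1 < 2.7182818286 := Real.exp_one_lt_d9
  have h12 : Real.exp 12 = Real.exp 1 ^ 12 := by rw [← Real.exp_nat_mul]; norm_num
  rw [h12]
  have h0 : 0 < Real.exp 1 := Real.exp_pos 1
  calc Real.exp 1 ^ 12 < 2.7182818286 ^ 12 := by gcongr
    _ < 358811 := by norm_num

/-- **Corollary (3.19): `log log x < Σ_{p ≤ x} 1/p` for every real `x > 1`, from (3.17)** (RS62: "COROLLARY"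
to Thm 5). The hypothesis is used only for `x ≥ 358 811` (there `log x > 12`, so `1/(2 log² x) < 1/288 < B`,
`B > 0.26146` by `MertensSecondChain.meisselMertens_gt`); below, the tree's `E₂ > 0` certificate gives it outright
(`B > 0`), and on `(1, 2)` `log log x < 0 = Σ`. [cite: RosserSchoenfeld1962, Thm. 5 Cor. (3.19), p. 70] -/
theorem RosserSchoenfeld1962_eq_3_19_of_3_17 (h : RosserSchoenfeld1962_eq_3_17) {x : ℝ} (hx : 1 < x) :
    Real.log (Real.log x) < primeRecipSum x := by
  have hB := MertensSecondChain.meisselMertens_gt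
  rcases lt_or_ge x 358811 with hx' | hx'
  · rcases lt_or_ge x 2 with h2 | h2
    · rw [primeRecipSum_eq_zero_of_lt_two (by linarith) h2]
      have hl : 0 < Real.log x := Real.log_pos hx
      have hl2 : Real.log x < Real.log 2 := Real.log_lt_log (by linarith) h2
      exact Real.log_neg hl (by linarith [log_two_lt_one])
    · have := MertensSecondChain.loglog_add_meisselMertens_lt_primeRecipSum h2 hx'
      linarith
  · have h17 := h x hx
    rw [← primeRecipSum_def] at h17
    have hl : 12 < Real.log x := twelve_lt_log_358811.trans_le (Real.log_le_log (by norm_num) hx')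
    have hsmall : 1 / (2 * Real.log x ^ 2) < 0.26146 := by
      rw [div_lt_iff₀ (by positivity)]
      nlinarith
    linarith

/-- (3.19) below `358 811` needs no hypothesis. [cite: RosserSchoenfeld1962, Thm. 5 Cor. (3.19) and Thm. 20] -/
theorem RosserSchoenfeld1962_eq_3_19_of_lt {x : ℝ} (hx : 1 < x) (hx' : x < 358811) :
    Real.log (Real.log x) < primeRecipSum x := by
  have h := RosserSchoenfeld1962_eq_3_17_of_lt hx hx'
  have hB := MertensSecondChain.meisselMertens_gt
  rcases lt_or_ge x 2 with h2 | h2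
  · rw [primeRecipSum_eq_zero_of_lt_two (by linarith) h2] at h ⊢
    have hl : 0 < Real.log x := Real.log_pos hx
    have hl2 : Real.log x < Real.log 2 := Real.log_lt_log (by linarith) h2
    exact Real.log_neg hl (by linarith [log_two_lt_one])
  · have := MertensSecondChain.loglog_add_meisselMertens_lt_primeRecipSum h2 hx'
    linarith

/-! ## §4 Consumer shapes: the symmetric envelope and block sums `Σ_{y < p ≤ z} 1/p` -/

/-- **Symmetric envelope from Theorem 5**: for `x ≥ 286`, `|Σ_{p ≤ x} 1/p − log log x − B| < 1/(2 log² x)`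
(the form in which certificates consume (3.17)/(3.18)). [cite: RosserSchoenfeld1962, Thm. 5 (3.17)–(3.18)] -/
theorem abs_primeRecipSum_sub_lt_of_thm5 (h17 : RosserSchoenfeld1962_eq_3_17)
    (h18 : RosserSchoenfeld1962_eq_3_18) {x : ℝ} (hx : 286 ≤ x) :
    |primeRecipSum x - Real.log (Real.log x) - meisselMertens| < 1 / (2 * Real.log x ^ 2) := by
  have h1 := h17 x (by linarith)
  have h2 := h18 x hx
  rw [← primeRecipSum_def] at h1 h2
  rw [abs_lt]
  constructor <;> linarith

/-- **Symmetric envelope for `x ≥ 3 594 641` from Dusart's `θ`-bound alone** (no RS62 hypothesis).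
[cite: RosserSchoenfeld1962, Thm. 5 (3.17)–(3.18)] [cite: Dusart2010, Thm. 5.2 (k = 2)] -/
theorem abs_primeRecipSum_sub_lt_of_dusart (h : Dusart2010_theta_thm_5_2) {x : ℝ} (hx : 3594641 ≤ x) :
    |primeRecipSum x - Real.log (Real.log x) - meisselMertens| < 1 / (2 * Real.log x ^ 2) := by
  have h5 := RosserSchoenfeld1962_thm5_of_dusart h hx
  rw [abs_lt]
  constructor <;> linarith [h5.1, h5.2]

/-- Block sums: for `y ≤ z`, `Σ_{y < p ≤ z} 1/p = P(z) − P(y)` with `P = Mertens.primeRecipSum` (the block is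
`{p prime : ⌊y⌋ < p ≤ ⌊z⌋}`, i.e. `y < p ≤ z` for primes `p`) — the shape in which (3.17)/(3.18) are differenced.
[cite: RosserSchoenfeld1962, Thm. 5 (3.17)–(3.18) (differenced form), p. 70] -/
theorem sum_primes_Ioc_inv_eq_sub {y z : ℝ} (hyz : y ≤ z) :
    ∑ p ∈ (Finset.Ioc ⌊y⌋₊ ⌊z⌋₊).filter Nat.Prime, (p : ℝ)⁻¹ = primeRecipSum z - primeRecipSum y := by
  have hfl : ⌊y⌋₊ ≤ ⌊z⌋₊ := Nat.floor_le_floor hyz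
  rw [primeRecipSum_def, primeRecipSum_def, Nat.primesLE_eq_filter_Ioc_zero, Nat.primesLE_eq_filter_Ioc_zero,
    eq_sub_iff_add_eq, ← Finset.sum_union]
  · congr 1
    rw [← Finset.filter_union, Finset.union_comm, Finset.Ioc_union_Ioc_eq_Ioc (Nat.zero_le _) hfl]
  · exact Finset.disjoint_filter_filter ((Finset.Ioc_disjoint_Ioc_of_le le_rfl).symm)

/-- **Two-sided block bound from Theorem 5**: for `286 ≤ y ≤ z`,
`|Σ_{y < p ≤ z} 1/p − (log log z − log log y)| < 1/(2 log² z) + 1/(2 log² y)`.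
[cite: RosserSchoenfeld1962, Thm. 5 (3.17)–(3.18)] -/
theorem abs_sum_primes_Ioc_inv_sub_lt_of_thm5 (h17 : RosserSchoenfeld1962_eq_3_17)
    (h18 : RosserSchoenfeld1962_eq_3_18) {y z : ℝ} (hy : 286 ≤ y) (hyz : y ≤ z) :
    |(∑ p ∈ (Finset.Ioc ⌊y⌋₊ ⌊z⌋₊).filter Nat.Prime, (p : ℝ)⁻¹) -
        (Real.log (Real.log z) - Real.log (Real.log y))| <
      1 / (2 * Real.log z ^ 2) + 1 / (2 * Real.log y ^ 2) := by
  rw [sum_primes_Ioc_inv_eq_sub hyz]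
  have hz := abs_primeRecipSum_sub_lt_of_thm5 h17 h18 (hy.trans hyz)
  have hy' := abs_primeRecipSum_sub_lt_of_thm5 h17 h18 hy
  rw [abs_lt] at hz hy' ⊢
  constructor <;> linarith [hz.1, hz.2, hy'.1, hy'.2]

/-- **Two-sided block bound for `3 594 641 ≤ y ≤ z` from Dusart's `θ`-bound alone.**
[cite: RosserSchoenfeld1962, Thm. 5 (3.17)–(3.18)] [cite: Dusart2010, Thm. 5.2 (k = 2)] -/
theorem abs_sum_primes_Ioc_inv_sub_lt_of_dusart (h : Dusart2010_theta_thm_5_2) {y z : ℝ}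
    (hy : 3594641 ≤ y) (hyz : y ≤ z) :
    |(∑ p ∈ (Finset.Ioc ⌊y⌋₊ ⌊z⌋₊).filter Nat.Prime, (p : ℝ)⁻¹) -
        (Real.log (Real.log z) - Real.log (Real.log y))| <
      1 / (2 * Real.log z ^ 2) + 1 / (2 * Real.log y ^ 2) := by
  rw [sum_primes_Ioc_inv_eq_sub hyz]
  have hz := abs_primeRecipSum_sub_lt_of_dusart h (hy.trans hyz)
  have hy' := abs_primeRecipSum_sub_lt_of_dusart h hy
  rw [abs_lt] at hz hy' ⊢
  constructor <;> linarith [hz.1, hz.2, hy'.1, hy'.2]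

/-! ## §5 Theorem 7 (and (3.28) of Theorem 8): Mertens' product `∏_{p ≤ x} (1 − 1/p)` -/

/-- NAMED FACT (**Rosser–Schoenfeld 1962, Thm. 7, (3.25)**): for real `x ≥ 285`,
`e^{−γ}/log x · (1 − 1/(2 log² x)) < ∏_{p ≤ x} (1 − 1/p)` (`γ` = Euler's constant, RS62's `C`). PROVED in the
tree, from `Dusart2010_theta_thm_5_2`, for `x ≥ 3 594 641` (`RosserSchoenfeld1962_thm7_of_dusart`).
[cite: RosserSchoenfeld1962, Thm. 7 (3.25), p. 70] -/
def RosserSchoenfeld1962_eq_3_25 : Prop :=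
  ∀ x : ℝ, 285 ≤ x →
    Real.exp (-Real.eulerMascheroniConstant) / Real.log x * (1 - 1 / (2 * Real.log x ^ 2)) <
      ∏ p ∈ Nat.primesLE ⌊x⌋₊, (1 - (p : ℝ)⁻¹)

/-- NAMED FACT (**Rosser–Schoenfeld 1962, Thm. 7, (3.26)**): for real `x > 1`,
`∏_{p ≤ x} (1 − 1/p) < e^{−γ}/log x · (1 + 1/(2 log² x))`. PROVED in the tree for `1 < x < 358 811`
(`RosserSchoenfeld1962_eq_3_26_of_lt`, from the kernel certificate `E₃ > 0` of `MertensThirdErrorPositive.lean`)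
and, from `Dusart2010_theta_thm_5_2`, for `x ≥ 3 594 641` (`RosserSchoenfeld1962_thm7_of_dusart`).
[cite: RosserSchoenfeld1962, Thm. 7 (3.26), p. 70] -/
def RosserSchoenfeld1962_eq_3_26 : Prop :=
  ∀ x : ℝ, 1 < x →
    ∏ p ∈ Nat.primesLE ⌊x⌋₊, (1 - (p : ℝ)⁻¹) <
      Real.exp (-Real.eulerMascheroniConstant) / Real.log x * (1 + 1 / (2 * Real.log x ^ 2))

/-! ### The product through `E₂` and the tail of `Σ_p (−log(1 − 1/p) − 1/p)` -/

/-- Each factor `1 − 1/p ≥ 1/2 > 0`. [folklore] -/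
private theorem one_sub_inv_pos_of_mem {n p : ℕ} (hp : p ∈ Nat.primesLE n) : 0 < 1 - (p : ℝ)⁻¹ := by
  have hp2 : (2 : ℝ) ≤ p := by exact_mod_cast (Nat.mem_primesLE.1 hp).2.two_le
  have : (p : ℝ)⁻¹ ≤ 1 / 2 := by rw [inv_eq_one_div]; gcongr
  linarith

/-- `∏_{p ≤ x} (1 − 1/p) > 0` (the product of RS62 Thm 7). [cite: RosserSchoenfeld1962, Thm. 7 (the product in (3.25)–(3.27)), p. 70] -/
theorem prod_one_sub_inv_pos (x : ℝ) : 0 < ∏ p ∈ Nat.primesLE ⌊x⌋₊, (1 - (p : ℝ)⁻¹) :=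
  Finset.prod_pos fun _ hp ↦ one_sub_inv_pos_of_mem hp

/-- The terms `a_k = −log(1 − 1/k) − 1/k` (primes `k`; else `0`) satisfy `a_k ≤ 2/k²`
(the tree's `Nicolas.abs_primeLogCoeff_sub_inv_le`). [cite: HardyWright2008, §22.7 eq. (22.7.1)] -/
theorem primeLogCoeffSubInv_le_two_div_sq (k : ℕ) : primeLogCoeffSubInv k ≤ 2 / (k : ℝ) ^ 2 := by
  by_cases hk : k.Prime
  · have h := Nicolas.abs_primeLogCoeff_sub_inv_le hk
    have e : primeLogCoeffSubInv k = Nicolas.primeLogCoeff k - (k : ℝ)⁻¹ := by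
      rw [Mertens.primeLogCoeffSubInv, if_pos hk, Nicolas.primeLogCoeff_of_prime hk]
    rw [e]
    exact (le_abs_self _).trans h
  · rw [Mertens.primeLogCoeffSubInv, if_neg hk]
    positivity

/-- Partial sums of the tail beyond `n ≥ 1`: `Σ_{k < m} a_{k+n+1} ≤ 2/n` (telescoping `2/i² ≤ 2/(i−1) − 2/i`;
Hardy–Wright bound this tail in the proof of Thm 429). [cite: HardyWright2008, §22.8, proof of Thm 429 (tail of (22.8.1))] -/
theorem sum_range_primeLogCoeffSubInv_shift_le {n : ℕ} (hn : 1 ≤ n) (m : ℕ) :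
    ∑ k ∈ Finset.range m, primeLogCoeffSubInv (k + (n + 1)) ≤ 2 / (n : ℝ) := by
  have hn0 : (0 : ℝ) < n := by exact_mod_cast hn
  set g : ℕ → ℝ := fun k ↦ 2 / ((k : ℝ) + n) with hg
  have hterm : ∀ k : ℕ, primeLogCoeffSubInv (k + (n + 1)) ≤ g k - g (k + 1) := by
    intro k
    refine (primeLogCoeffSubInv_le_two_div_sq _).trans ?_
    have hk0 : (0 : ℝ) ≤ k := Nat.cast_nonneg k
    simp only [hg]
    push_cast
    have e : 2 / ((k : ℝ) + n) - 2 / ((k : ℝ) + 1 + n) = 2 / (((k : ℝ) + n) * ((k : ℝ) + 1 + n)) := by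
      field_simp
      ring
    rw [e]
    exact div_le_div_of_nonneg_left (by norm_num) (by positivity) (by nlinarith)
  calc ∑ k ∈ Finset.range m, primeLogCoeffSubInv (k + (n + 1))
      ≤ ∑ k ∈ Finset.range m, (g k - g (k + 1)) := Finset.sum_le_sum fun k _ ↦ hterm k
    _ = g 0 - g m := Finset.sum_range_sub' g m
    _ ≤ g 0 := by
        have : 0 ≤ g m := by simp only [hg]; positivity
        linarith
    _ = 2 / (n : ℝ) := by simp [hg]

/-- The tail `T(n) = Σ_{k > n} a_k` (`n ≥ 1`) satisfies `0 ≤ T(n) ≤ 2/n`.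
[cite: HardyWright2008, §22.8, proof of Thm 429 (tail of (22.8.1))] -/
theorem tsum_primeLogCoeffSubInv_shift_le {n : ℕ} (hn : 1 ≤ n) :
    0 ≤ ∑' k, primeLogCoeffSubInv (k + (n + 1)) ∧ ∑' k, primeLogCoeffSubInv (k + (n + 1)) ≤ 2 / (n : ℝ) :=
  ⟨tsum_nonneg fun _ ↦ MertensSecondChain.primeLogCoeffSubInv_nonneg _,
    Real.tsum_le_of_sum_range_le (fun _ ↦ MertensSecondChain.primeLogCoeffSubInv_nonneg _)
      (sum_range_primeLogCoeffSubInv_shift_le hn)⟩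

/-- **Mertens' product through the Mertens-II error**: for `x > 1`,
`∏_{p ≤ x} (1 − 1/p) = (e^{−γ}/log x) · exp(T(x) − E₂(x))`, where `E₂(x) = Σ_{p≤x} 1/p − log log x − B` and
`T(x) = Σ_{k > ⌊x⌋} a_k` is the tail of `γ − B = Σ_k a_k`, `a_p = −log(1 − 1/p) − 1/p` (Hardy–Wright (22.8.1);
RS62 (2.7) and §8, (8.10)). [cite: RosserSchoenfeld1962, (2.7) and §8 (8.10), p. 87] -/
theorem prod_one_sub_inv_eq_exp {x : ℝ} (hx : 1 < x) :
    ∏ p ∈ Nat.primesLE ⌊x⌋₊, (1 - (p : ℝ)⁻¹) =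
      Real.exp (-Real.eulerMascheroniConstant) / Real.log x *
        Real.exp ((∑' k, primeLogCoeffSubInv (k + (⌊x⌋₊ + 1))) -
          (primeRecipSum x - Real.log (Real.log x) - meisselMertens)) := by
  have hlx : 0 < Real.log x := Real.log_pos hx
  have hA : ∏ p ∈ Nat.primesLE ⌊x⌋₊, (1 - (p : ℝ)⁻¹) = Real.exp (-(Nicolas.mertensLog x)) := by
    have h : Real.exp (Nicolas.mertensLog x) = (∏ p ∈ Nat.primesLE ⌊x⌋₊, (1 - (p : ℝ)⁻¹))⁻¹ := by
      rw [Nicolas.mertensLog_eq_natCast_floor, Nicolas.exp_mertensLog_natCast, Finset.prod_inv_distrib]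
    rw [Real.exp_neg, h, inv_inv]
  have hsplit := Mertens.summable_primeLogCoeffSubInv.sum_add_tsum_nat_add (⌊x⌋₊ + 1)
  have hAP := Mertens.mertensLog_sub_primeRecipSum x
  have hγB := MertensSecondChain.eulerMascheroni_sub_meisselMertens_eq_tsum
  have hneg : -(Nicolas.mertensLog x) = -Real.eulerMascheroniConstant + -Real.log (Real.log x) +
      ((∑' k, primeLogCoeffSubInv (k + (⌊x⌋₊ + 1))) -
        (primeRecipSum x - Real.log (Real.log x) - meisselMertens)) := by
    linarith
  rw [hA, hneg, Real.exp_add, Real.exp_add, Real.exp_neg (Real.log (Real.log x)), Real.exp_log hlx,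
    div_eq_mul_inv]

/-- **Two-sided product bound from a bound on the Mertens-II error**: if `|Σ_{p≤x} 1/p − log log x − B| ≤ ε`
(`x ≥ 2`), then `(e^{−γ}/log x)·e^{−ε} ≤ ∏_{p ≤ x}(1 − 1/p) ≤ (e^{−γ}/log x)·e^{ε + 2/⌊x⌋}`.
[cite: RosserSchoenfeld1962, §8 (proof of Thms. 7–8 from Lemma 13), p. 87] -/
theorem prod_one_sub_inv_bounds_of_abs_le {x ε : ℝ} (hx : 2 ≤ x)
    (hE : |primeRecipSum x - Real.log (Real.log x) - meisselMertens| ≤ ε) :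
    Real.exp (-Real.eulerMascheroniConstant) / Real.log x * Real.exp (-ε) ≤
        ∏ p ∈ Nat.primesLE ⌊x⌋₊, (1 - (p : ℝ)⁻¹) ∧
      ∏ p ∈ Nat.primesLE ⌊x⌋₊, (1 - (p : ℝ)⁻¹) ≤
        Real.exp (-Real.eulerMascheroniConstant) / Real.log x * Real.exp (ε + 2 / (⌊x⌋₊ : ℝ)) := by
  have hx1 : 1 < x := by linarith
  have hlx : 0 < Real.log x := Real.log_pos hx1
  have hfl : 1 ≤ ⌊x⌋₊ := Nat.le_floor (by exact_mod_cast hx1.le)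
  have hT := tsum_primeLogCoeffSubInv_shift_le hfl
  have hc : 0 < Real.exp (-Real.eulerMascheroniConstant) / Real.log x := by positivity
  rw [prod_one_sub_inv_eq_exp hx1]
  rw [abs_le] at hE
  constructor
  · refine mul_le_mul_of_nonneg_left (Real.exp_le_exp.2 ?_) hc.le
    linarith [hT.1, hE.2]
  · refine mul_le_mul_of_nonneg_left (Real.exp_le_exp.2 ?_) hc.le
    linarith [hT.2, hE.1]

/-- **The large-`x` step of Theorem 7**: if `|θ(y) − y| ≤ η y/log² y` for `y ≥ X ≥ 2` then for `x ≥ X`, with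
`ε(x) = 2η(1 + 1/log X)/log² x`,
`(e^{−γ}/log x)·e^{−ε(x)} ≤ ∏_{p ≤ x}(1 − 1/p) ≤ (e^{−γ}/log x)·e^{ε(x) + 2/⌊x⌋}`.
[cite: RosserSchoenfeld1962, Thm. 7 (3.25)–(3.26), proof §8 p. 87] -/
theorem prod_one_sub_inv_bounds_of_theta {η X : ℝ} (hX : 2 ≤ X) (hη : 0 ≤ η)
    (hθ : ∀ y, X ≤ y → |θ y - y| ≤ η * y / Real.log y ^ 2) {x : ℝ} (hx : X ≤ x) :
    Real.exp (-Real.eulerMascheroniConstant) / Real.log x *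
          Real.exp (-(2 * η * (1 + 1 / Real.log X) / Real.log x ^ 2)) ≤
        ∏ p ∈ Nat.primesLE ⌊x⌋₊, (1 - (p : ℝ)⁻¹) ∧
      ∏ p ∈ Nat.primesLE ⌊x⌋₊, (1 - (p : ℝ)⁻¹) ≤
        Real.exp (-Real.eulerMascheroniConstant) / Real.log x *
          Real.exp (2 * η * (1 + 1 / Real.log X) / Real.log x ^ 2 + 2 / (⌊x⌋₊ : ℝ)) :=
  prod_one_sub_inv_bounds_of_abs_le (hX.trans hx)
    (abs_primeRecipSum_sub_loglog_sub_meisselMertens_le_of_theta hX hη hθ hx)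

/-- `log 3594641 > 15` (`e¹⁵ < 2.7182818286¹⁵ < 3 594 641`). [folklore] -/
private theorem fifteen_lt_log_dusartX : 15 < Real.log 3594641 := by
  rw [Real.lt_log_iff_exp_lt (by norm_num)]
  have h1 : Real.exp 1 < 2.7182818286 := Real.exp_one_lt_d9
  have h15 : Real.exp 15 = Real.exp 1 ^ 15 := by rw [← Real.exp_nat_mul]; norm_num
  rw [h15]
  have h0 : 0 < Real.exp 1 := Real.exp_pos 1
  calc Real.exp 1 ^ 15 < 2.7182818286 ^ 15 := by gcongr
    _ < 3594641 := by norm_num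

/-- `log² x ≤ 16 √x` for `x ≥ 1` (`log x ≤ 4 x^{1/4}`, Mathlib `Real.log_le_rpow_div`). [folklore] -/
private theorem log_sq_le_sixteen_mul_sqrt {x : ℝ} (hx : 1 ≤ x) : Real.log x ^ 2 ≤ 16 * Real.sqrt x := by
  have hx0 : 0 ≤ x := by linarith
  have h := Real.log_le_rpow_div hx0 (show (0 : ℝ) < 1 / 4 by norm_num)
  have hl : 0 ≤ Real.log x := Real.log_nonneg hx
  have h4 : Real.log x ≤ 4 * x ^ (1 / 4 : ℝ) := by linarith [h]
  have hr : 0 ≤ x ^ (1 / 4 : ℝ) := Real.rpow_nonneg hx0 _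
  calc Real.log x ^ 2 ≤ (4 * x ^ (1 / 4 : ℝ)) ^ 2 := pow_le_pow_left₀ hl h4 2
    _ = 16 * (x ^ (1 / 4 : ℝ)) ^ 2 := by ring
    _ = 16 * Real.sqrt x := by
        rw [← Real.rpow_natCast, ← Real.rpow_mul hx0, Real.sqrt_eq_rpow]
        norm_num

set_option maxHeartbeats 400000 in
/-- **Theorem 7, (3.25) ∧ (3.26), for every `x ≥ 3 594 641`, from Dusart's `θ`-bound** (the tree's named fact
`Dusart2010_theta_thm_5_2`). Numerics: with `L = log x ≥ log 3594641 > 15`, `ε L² = 0.4(1 + 1/log 3594641) <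
0.4267`, `(2/⌊x⌋) L² < 64/√x ≤ 64/1895 < 0.0338`, so `u = ε + 2/⌊x⌋ < 0.4605/L² ≤ 0.00205` and
`e^u ≤ 1 + u + u² < 1 + 1/(2L²)`, `e^{−ε} ≥ 1 − ε > 1 − 1/(2L²)`.
[cite: RosserSchoenfeld1962, Thm. 7 (3.25)–(3.26)] [cite: Dusart2010, Thm. 5.2 (k = 2)] -/
theorem RosserSchoenfeld1962_thm7_of_dusart (h : Dusart2010_theta_thm_5_2) {x : ℝ} (hx : 3594641 ≤ x) :
    Real.exp (-Real.eulerMascheroniConstant) / Real.log x * (1 - 1 / (2 * Real.log x ^ 2)) <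
        ∏ p ∈ Nat.primesLE ⌊x⌋₊, (1 - (p : ℝ)⁻¹) ∧
      ∏ p ∈ Nat.primesLE ⌊x⌋₊, (1 - (p : ℝ)⁻¹) <
        Real.exp (-Real.eulerMascheroniConstant) / Real.log x * (1 + 1 / (2 * Real.log x ^ 2)) := by
  have hb := prod_one_sub_inv_bounds_of_theta (η := 0.2) (X := 3594641) (by norm_num) (by norm_num)
    (fun y hy ↦ (h y hy).le) hx
  set L := Real.log x with hL
  set P := ∏ p ∈ Nat.primesLE ⌊x⌋₊, (1 - (p : ℝ)⁻¹) with hP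
  set c := Real.exp (-Real.eulerMascheroniConstant) / L with hc
  set ε := 2 * (0.2 : ℝ) * (1 + 1 / Real.log 3594641) / L ^ 2 with hε
  set δ := 2 / (⌊x⌋₊ : ℝ) with hδ
  have hX15 := fifteen_lt_log_dusartX
  have hX0 : 0 < Real.log 3594641 := by linarith
  have hLX : Real.log 3594641 ≤ L := Real.log_le_log (by norm_num) hx
  have hL15 : 15 < L := hX15.trans_le hLX
  have hL0 : 0 < L := by linarith
  have hL2 : (225 : ℝ) < L ^ 2 := by
    have h1 : (15 : ℝ) ^ 2 < L ^ 2 := pow_lt_pow_left₀ hL15 (by norm_num) two_ne_zero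
    norm_num at h1
    exact h1
  have hL2pos : 0 < L ^ 2 := by positivity
  have hcpos : 0 < c := by positivity
  -- `ε L² < 0.4267`
  have hinvX : 1 / Real.log 3594641 < 1 / 15 := by
    rw [one_div_lt_one_div hX0 (by norm_num)]
    exact hX15
  have hεL : ε * L ^ 2 < 0.4267 := by
    have e : ε * L ^ 2 = 2 * 0.2 * (1 + 1 / Real.log 3594641) := by
      rw [hε]
      field_simp
    rw [e]
    linarith
  have hε0 : 0 ≤ ε := by positivity
  -- `δ L² < 0.034`
  have hx0 : 0 < x := by linarith
  have hfl : x / 2 ≤ (⌊x⌋₊ : ℝ) := by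
    have := Nat.lt_floor_add_one x
    linarith
  have hflpos : 0 < (⌊x⌋₊ : ℝ) := by linarith
  have hδ4 : δ ≤ 4 / x := by
    rw [hδ, div_le_div_iff₀ hflpos hx0]
    linarith
  have hsqrt : 1895 ≤ Real.sqrt x := by
    rw [Real.le_sqrt (by norm_num) hx0.le]
    norm_num
    linarith
  have hsqrt0 : 0 < Real.sqrt x := by linarith
  have hsx : Real.sqrt x * Real.sqrt x = x := Real.mul_self_sqrt hx0.le
  have hLsq : L ^ 2 ≤ 16 * Real.sqrt x := log_sq_le_sixteen_mul_sqrt (by linarith)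
  have hδ0 : 0 ≤ δ := by positivity
  have hδL : δ * L ^ 2 < 0.034 := by
    have h64 : 64 * Real.sqrt x < 0.034 * x :=
      calc 64 * Real.sqrt x < 0.034 * 1895 * Real.sqrt x := mul_lt_mul_of_pos_right (by norm_num) hsqrt0
        _ ≤ 0.034 * Real.sqrt x * Real.sqrt x :=
            mul_le_mul_of_nonneg_right (mul_le_mul_of_nonneg_left hsqrt (by norm_num)) hsqrt0.le
        _ = 0.034 * x := by rw [mul_assoc, hsx]
    calc δ * L ^ 2 ≤ 4 / x * (16 * Real.sqrt x) := mul_le_mul hδ4 hLsq hL2pos.le (by positivity)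
      _ = 64 * Real.sqrt x / x := by ring
      _ < 0.034 := by
          rw [div_lt_iff₀ hx0]
          exact h64
  -- `u = ε + δ`
  have hu : (ε + δ) * L ^ 2 < 0.4607 := by linarith
  have hu0 : 0 ≤ ε + δ := by positivity
  have hu_small : ε + δ ≤ 0.00205 := by
    have h1 : (ε + δ) * 225 ≤ (ε + δ) * L ^ 2 := mul_le_mul_of_nonneg_left hL2.le hu0
    linarith
  have hexp_up : Real.exp (ε + δ) < 1 + 1 / (2 * L ^ 2) := by
    have habs : |ε + δ| ≤ 1 := by
      rw [abs_of_nonneg hu0]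
      linarith
    have h1 := Real.abs_exp_sub_one_sub_id_le habs
    have h2 : Real.exp (ε + δ) ≤ 1 + (ε + δ) + (ε + δ) ^ 2 := by
      have := (abs_le.1 h1).2
      linarith
    have key : ((ε + δ) + (ε + δ) ^ 2) * L ^ 2 < 1 / 2 := by
      have e : ((ε + δ) + (ε + δ) ^ 2) * L ^ 2 = (ε + δ) * L ^ 2 * (1 + (ε + δ)) := by ring
      rw [e]
      calc (ε + δ) * L ^ 2 * (1 + (ε + δ)) ≤ 0.4607 * (1 + 0.00205) :=
            mul_le_mul hu.le (by linarith) (by positivity) (by norm_num)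
        _ < 1 / 2 := by norm_num
    have h3 : (ε + δ) + (ε + δ) ^ 2 < 1 / (2 * L ^ 2) := by
      rw [lt_div_iff₀ (by positivity)]
      linarith
    linarith
  have hexp_lo : 1 - 1 / (2 * L ^ 2) < Real.exp (-ε) := by
    have h1 : -ε + 1 ≤ Real.exp (-ε) := Real.add_one_le_exp (-ε)
    have h2 : ε < 1 / (2 * L ^ 2) := by
      rw [lt_div_iff₀ (by positivity)]
      linarith
    linarith
  constructor
  · calc c * (1 - 1 / (2 * L ^ 2)) < c * Real.exp (-ε) := mul_lt_mul_of_pos_left hexp_lo hcpos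
      _ ≤ P := hb.1
  · calc P ≤ c * Real.exp (ε + δ) := hb.2
      _ < c * (1 + 1 / (2 * L ^ 2)) := mul_lt_mul_of_pos_left hexp_up hcpos

/-! ### Unconditional range of (3.26) from the `E₃ > 0` certificate; (3.28) from (3.26) -/

/-- For `2 ≤ x < 358 811`: `∏_{p ≤ x} (1 − 1/p) < e^{−γ}/log x`, i.e. RS62 Thm 23's `E₃(x) > 0`, certified in the
tree (`Zhao2025.E₃_pos_of_lt`, `MertensThirdErrorPositive.lean`). [cite: RosserSchoenfeld1962, Thm. 23 and p. 87] -/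
theorem prod_one_sub_inv_lt_of_lt {x : ℝ} (h2 : 2 ≤ x) (hx' : x < 358811) :
    ∏ p ∈ Nat.primesLE ⌊x⌋₊, (1 - (p : ℝ)⁻¹) < Real.exp (-Real.eulerMascheroniConstant) / Real.log x := by
  have h := Zhao2025.E₃_pos_of_lt h2 hx'
  have hlx : 0 < Real.log x := Real.log_pos (by linarith)
  unfold Zhao2025.E₃ at h
  rw [Finset.prod_inv_distrib] at h
  set P := ∏ p ∈ Nat.primesLE ⌊x⌋₊, (1 - (p : ℝ)⁻¹) with hP
  have hP0 : 0 < P := prod_one_sub_inv_pos x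
  have hγ : 0 < Real.exp Real.eulerMascheroniConstant := Real.exp_pos _
  have h1 : Real.exp Real.eulerMascheroniConstant < P⁻¹ / Real.log x := by linarith
  rw [lt_div_iff₀ hlx] at h1
  -- `exp γ · log x · P < 1`
  have h2 : Real.exp Real.eulerMascheroniConstant * Real.log x * P < 1 := by
    have := mul_lt_mul_of_pos_right h1 hP0
    rwa [inv_mul_cancel₀ hP0.ne'] at this
  rw [Real.exp_neg, ← one_div, div_div, lt_div_iff₀ (by positivity)]
  linarith

/-- `e^{γ} < 2` (`γ < 2/3`, `(e^{2/3})³ = e² < 2.72² < 8`). [folklore] -/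
private theorem exp_eulerMascheroni_lt_two : Real.exp Real.eulerMascheroniConstant < 2 := by
  have hγ := Real.eulerMascheroniConstant_lt_two_thirds
  have h1 : Real.exp Real.eulerMascheroniConstant < Real.exp (2 / 3) := Real.exp_lt_exp.2 hγ
  have h2 : Real.exp (2 / 3 : ℝ) < 2 := by
    refine lt_of_pow_lt_pow_left₀ 3 (by norm_num) ?_
    rw [← Real.exp_nat_mul]
    norm_num
    have he : Real.exp 1 < 2.7182818286 := Real.exp_one_lt_d9
    have h0 : 0 < Real.exp 1 := Real.exp_pos 1
    have e2 : Real.exp 2 = Real.exp 1 ^ 2 := by rw [← Real.exp_nat_mul]; norm_num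
    rw [e2]
    nlinarith
  linarith

/-- **(3.26) for `1 < x < 358 811`, UNCONDITIONALLY** (on `[2, 358811)` from `prod_one_sub_inv_lt_of_lt`; on `(1, 2)`
the product is empty and the right side exceeds `1`: `e^{−γ} > 1/2`, `1/(2 log² x) > 1`, `log x < 1`).
[cite: RosserSchoenfeld1962, Thm. 7 (3.26) and Thm. 23] -/
theorem RosserSchoenfeld1962_eq_3_26_of_lt {x : ℝ} (hx : 1 < x) (hx' : x < 358811) :
    ∏ p ∈ Nat.primesLE ⌊x⌋₊, (1 - (p : ℝ)⁻¹) <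
      Real.exp (-Real.eulerMascheroniConstant) / Real.log x * (1 + 1 / (2 * Real.log x ^ 2)) := by
  have hlx : 0 < Real.log x := Real.log_pos hx
  have hc : 0 < Real.exp (-Real.eulerMascheroniConstant) / Real.log x := by positivity
  rcases lt_or_ge x 2 with h2 | h2
  · have hx0 : 0 ≤ x := by linarith
    have hfl : ⌊x⌋₊ ≤ 1 := by
      have : ⌊x⌋₊ < 2 := (Nat.floor_lt hx0).2 (by exact_mod_cast h2)
      omega
    have hempty : Nat.primesLE ⌊x⌋₊ = ∅ := by
      interval_cases h : ⌊x⌋₊ <;> simp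
    rw [hempty, Finset.prod_empty]
    -- the right side exceeds `1`
    have hl2 : Real.log x < Real.log 2 := Real.log_lt_log (by linarith) h2
    have hlog2 := Real.log_two_lt_d9
    have hL1 : Real.log x < 1 := by linarith
    have hsq : 2 * Real.log x ^ 2 < 1 := by nlinarith
    have hbig : 1 < 1 / (2 * Real.log x ^ 2) := by
      rw [lt_div_iff₀ (by positivity)]
      linarith
    have hγ : 1 / 2 < Real.exp (-Real.eulerMascheroniConstant) := by
      rw [Real.exp_neg, ← one_div, one_div_lt_one_div (by norm_num) (Real.exp_pos _)]
      exact exp_eulerMascheroni_lt_two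
    have hA : 1 / (2 * Real.log x) < Real.exp (-Real.eulerMascheroniConstant) / Real.log x := by
      rw [div_lt_div_iff₀ (by positivity) hlx]
      nlinarith
    have hB : 2 < 1 + 1 / (2 * Real.log x ^ 2) := by linarith
    have hprod := mul_lt_mul'' hA hB (by positivity) (by norm_num)
    have e : 1 / (2 * Real.log x) * 2 = 1 / Real.log x := by
      field_simp
    have hL' : 1 < 1 / Real.log x := one_lt_one_div hlx hL1
    linarith
  · have h := prod_one_sub_inv_lt_of_lt h2 hx'
    have h1 : Real.exp (-Real.eulerMascheroniConstant) / Real.log x <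
        Real.exp (-Real.eulerMascheroniConstant) / Real.log x * (1 + 1 / (2 * Real.log x ^ 2)) := by
      refine lt_mul_of_one_lt_right hc ?_
      have : 0 < 1 / (2 * Real.log x ^ 2) := by positivity
      linarith
    linarith

/-- `∏_{p ≤ x} p/(p − 1) = (∏_{p ≤ x} (1 − 1/p))⁻¹` (Thm 8 is Thm 7 inverted: "Inverting both sides gives (3.28)").
[cite: RosserSchoenfeld1962, Thm. 8 and §8 p. 87] -/
theorem prod_div_pred_eq_inv (x : ℝ) :
    ∏ p ∈ Nat.primesLE ⌊x⌋₊, (p : ℝ) / ((p : ℝ) - 1) = (∏ p ∈ Nat.primesLE ⌊x⌋₊, (1 - (p : ℝ)⁻¹))⁻¹ := by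
  rw [← Finset.prod_inv_distrib]
  refine Finset.prod_congr rfl fun p hp ↦ ?_
  have hp2 : (2 : ℝ) ≤ p := by exact_mod_cast (Nat.mem_primesLE.1 hp).2.two_le
  have hp0 : (p : ℝ) ≠ 0 := by positivity
  have hp1 : (p : ℝ) - 1 ≠ 0 := by linarith
  field_simp

/-- **(3.28) from (3.26)** ("Inverting both sides gives (3.28)", RS62 §8, p. 87): for `x > 1`,
`e^{γ} log x · (1 − 1/(2 log² x)) < ∏_{p ≤ x} p/(p − 1)` (`1/(1 + u) ≥ 1 − u`).
[cite: RosserSchoenfeld1962, Thm. 8 (3.28), proof p. 87] -/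
theorem RosserSchoenfeld1962_eq_3_28_of_3_26 (h : RosserSchoenfeld1962_eq_3_26) {x : ℝ} (hx : 1 < x) :
    Real.exp Real.eulerMascheroniConstant * Real.log x * (1 - 1 / (2 * Real.log x ^ 2)) <
      ∏ p ∈ Nat.primesLE ⌊x⌋₊, (p : ℝ) / ((p : ℝ) - 1) := by
  have h26 := h x hx
  have hlx : 0 < Real.log x := Real.log_pos hx
  rw [prod_div_pred_eq_inv]
  set P := ∏ p ∈ Nat.primesLE ⌊x⌋₊, (1 - (p : ℝ)⁻¹) with hP
  set L := Real.log x with hL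
  set u := 1 / (2 * L ^ 2) with hu
  have hP0 : 0 < P := prod_one_sub_inv_pos x
  have hγ : 0 < Real.exp Real.eulerMascheroniConstant := Real.exp_pos _
  have hu0 : 0 < u := by positivity
  rcases le_or_gt (1 - u) 0 with hneg | hpos
  · have : Real.exp Real.eulerMascheroniConstant * L * (1 - u) ≤ 0 :=
      mul_nonpos_of_nonneg_of_nonpos (by positivity) hneg
    linarith [inv_pos.2 hP0]
  · rw [← one_div, lt_div_iff₀ hP0]
    have hcu : 0 < Real.exp Real.eulerMascheroniConstant * L * (1 - u) := by positivity
    have e : Real.exp (-Real.eulerMascheroniConstant) / L * (1 + u) *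
        (Real.exp Real.eulerMascheroniConstant * L * (1 - u)) = 1 - u ^ 2 := by
      rw [Real.exp_neg]
      field_simp
      ring
    calc Real.exp Real.eulerMascheroniConstant * L * (1 - u) * P
        < Real.exp Real.eulerMascheroniConstant * L * (1 - u) *
            (Real.exp (-Real.eulerMascheroniConstant) / L * (1 + u)) := mul_lt_mul_of_pos_left h26 hcu
      _ = 1 - u ^ 2 := by rw [mul_comm]; exact e
      _ ≤ 1 := by nlinarith

/-- **(3.28) for `1 < x < 358 811`, UNCONDITIONALLY.** [cite: RosserSchoenfeld1962, Thm. 8 (3.28) and Thm. 23] -/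
theorem RosserSchoenfeld1962_eq_3_28_of_lt {x : ℝ} (hx : 1 < x) (hx' : x < 358811) :
    Real.exp Real.eulerMascheroniConstant * Real.log x * (1 - 1 / (2 * Real.log x ^ 2)) <
      ∏ p ∈ Nat.primesLE ⌊x⌋₊, (p : ℝ) / ((p : ℝ) - 1) := by
  -- the proof of `RosserSchoenfeld1962_eq_3_28_of_3_26` uses (3.26) only at `x`
  have h26 := RosserSchoenfeld1962_eq_3_26_of_lt hx hx'
  have hlx : 0 < Real.log x := Real.log_pos hx
  rw [prod_div_pred_eq_inv]
  set P := ∏ p ∈ Nat.primesLE ⌊x⌋₊, (1 - (p : ℝ)⁻¹) with hP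
  set L := Real.log x with hL
  set u := 1 / (2 * L ^ 2) with hu
  have hP0 : 0 < P := prod_one_sub_inv_pos x
  have hγ : 0 < Real.exp Real.eulerMascheroniConstant := Real.exp_pos _
  have hu0 : 0 < u := by positivity
  rcases le_or_gt (1 - u) 0 with hneg | hpos
  · have : Real.exp Real.eulerMascheroniConstant * L * (1 - u) ≤ 0 :=
      mul_nonpos_of_nonneg_of_nonpos (by positivity) hneg
    linarith [inv_pos.2 hP0]
  · rw [← one_div, lt_div_iff₀ hP0]
    have hcu : 0 < Real.exp Real.eulerMascheroniConstant * L * (1 - u) := by positivity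
    have e : Real.exp (-Real.eulerMascheroniConstant) / L * (1 + u) *
        (Real.exp Real.eulerMascheroniConstant * L * (1 - u)) = 1 - u ^ 2 := by
      rw [Real.exp_neg]
      field_simp
      ring
    calc Real.exp Real.eulerMascheroniConstant * L * (1 - u) * P
        < Real.exp Real.eulerMascheroniConstant * L * (1 - u) *
            (Real.exp (-Real.eulerMascheroniConstant) / L * (1 + u)) := mul_lt_mul_of_pos_left h26 hcu
      _ = 1 - u ^ 2 := by rw [mul_comm]; exact e
      _ ≤ 1 := by nlinarith

/-- **(3.28) for `x ≥ 3 594 641` from Dusart's `θ`-bound.**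
[cite: RosserSchoenfeld1962, Thm. 8 (3.28)] [cite: Dusart2010, Thm. 5.2 (k = 2)] -/
theorem RosserSchoenfeld1962_eq_3_28_of_dusart (h : Dusart2010_theta_thm_5_2) {x : ℝ} (hx : 3594641 ≤ x) :
    Real.exp Real.eulerMascheroniConstant * Real.log x * (1 - 1 / (2 * Real.log x ^ 2)) <
      ∏ p ∈ Nat.primesLE ⌊x⌋₊, (p : ℝ) / ((p : ℝ) - 1) := by
  have h26 := (RosserSchoenfeld1962_thm7_of_dusart h hx).2
  have hx1 : 1 < x := by linarith
  have hlx : 0 < Real.log x := Real.log_pos hx1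
  rw [prod_div_pred_eq_inv]
  set P := ∏ p ∈ Nat.primesLE ⌊x⌋₊, (1 - (p : ℝ)⁻¹) with hP
  set L := Real.log x with hL
  set u := 1 / (2 * L ^ 2) with hu
  have hP0 : 0 < P := prod_one_sub_inv_pos x
  have hγ : 0 < Real.exp Real.eulerMascheroniConstant := Real.exp_pos _
  have hu0 : 0 < u := by positivity
  rcases le_or_gt (1 - u) 0 with hneg | hpos
  · have : Real.exp Real.eulerMascheroniConstant * L * (1 - u) ≤ 0 :=
      mul_nonpos_of_nonneg_of_nonpos (by positivity) hneg
    linarith [inv_pos.2 hP0]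
  · rw [← one_div, lt_div_iff₀ hP0]
    have hcu : 0 < Real.exp Real.eulerMascheroniConstant * L * (1 - u) := by positivity
    have e : Real.exp (-Real.eulerMascheroniConstant) / L * (1 + u) *
        (Real.exp Real.eulerMascheroniConstant * L * (1 - u)) = 1 - u ^ 2 := by
      rw [Real.exp_neg]
      field_simp
      ring
    calc Real.exp Real.eulerMascheroniConstant * L * (1 - u) * P
        < Real.exp Real.eulerMascheroniConstant * L * (1 - u) *
            (Real.exp (-Real.eulerMascheroniConstant) / L * (1 + u)) := mul_lt_mul_of_pos_left h26 hcu
      _ = 1 - u ^ 2 := by rw [mul_comm]; exact e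
      _ ≤ 1 := by nlinarith

end Literature.NumberTheory.LFunctions

end
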